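import Summits.BirchSwinnertonDyer.BirchSwinnertonDyer.Theorems.KimAtThreeStubOfLiftable
import Summits.BirchSwinnertonDyer.BirchSwinnertonDyer.Theorems.KimAtThreeStubLiftability
import Summits.BirchSwinnertonDyer.BirchSwinnertonDyer.Theorems.KimAtThreeStubPushforward
import HarnessLib

/-!
# Route `KimAtThreeKolyvagin` (rung W2), crux `StubAtEmptyLevelThree` (item 19561): ASSEMBLY of the
# "stub from liftability" road — the 19561 conclusion from four displayed inputs

Cell `bsd-addord`, seat `bsd-addord-w2-c2` (gen 3). TOOL FILE: one theorem, no definition, no named fact, no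
`sorry`; closes nothing; books nothing. HONEST FRAMING: BSD is not proved by any of this; item 19561
(Mazur–Rubin Thm. 4.4.1 / 4.3.4 at the empty level, general modulus `3^{k+1}`, transported to `p = 3`) stays
OPEN. This file composes the three landed pieces of the road — the algebra of MR Thm. 4.4.3 Case 1
(`KimAtThreeStubOfLiftableAlgebra`), its tree-currency form with the kernel and the propagation inclusion
discharged under surj(3) (`KimAtThreeStubOfLiftable`), the liftability of the bottom class through a core
vertex (`KimAtThreeStubLiftability`) and the multi-step push-forward (`KimAtThreeStubPushforward`) — into
ONE statement whose remaining hypotheses are exactly: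

* (L-a) RIGIDITY at one level `d₀ ⊆ 𝒫̃` on the Kolyvagin systems of `(E[3^{k+1}], 𝓕_can, 𝒫̃)` (vanishing at
  `d₀` ⟹ vanishing at `∅`; = cell n1011's `TorsionLevel.injective_eval_kolyvaginSystems_allDepths` over the
  `m = 1` rigidity at the core vertex `d₀`, `CoreRankOne.apply_eq_zero_of_apply_core_eq_zero`, on the deep
  class);
* (L-c) PROPORTIONALITY at `d₀`: `red_*(g̃_{d₀}) = w·g_{d₀}` with `3 ∤ w` (at a core vertex both classes
  generate the free rank-one stalk and `red_*` is onto: [S24] Thm. 4.4 (2) + pair counts at both depths, the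
  shape of `Transport.pow_dvd_iff_of_comp` S2–S3);
* (iii) the three COUNTS `#H¹_{𝓕_can}(ℚ, E[3^{k̃+1}])[3^i] = 3^{i+n₀}` at `i = k̃−k, k̃, k̃+1` (MR Thm. 4.1.13 with
  `χ = 1` + saturation of the dual Selmer group, `n₀ < k + 1 ≤ k̃ − k + 1`);
* (iv) the ORDER `ord(g_∅)·3^{n₀} = 3^{k+1}` ([S24] Thm. 4.4 (2), clause 1, verbatim).

Everything else — the reduction `red` (any equivariant map which is `3^{k̃−k}` on points), the data (same
primes `𝒫̃` at the lift level, `𝒫̃ ⊆ 𝒫_k`, inside the class of `τ` at level `3^{k̃+1}`, outside `S`;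
cyclotomic transverse conditions; THE canonical comparison maps for one `η`) — is the shape the TowerPackage
/ deep-family constructors of cell n1011 produce.

References: [MazurRubin2004] Lemma 4.1.1, Thm. 4.1.13, Thm. 4.4.1, Thm. 4.4.3 (pp. 35–47; held text
`HOME/lit/mazurrubin2004/txt-authors-pdf/p0041–p0053`); [Sakamoto2024] Def. 4.1, Thm. 4.4; [Rubin2011] Thm. 2.8.4.
-/

-- the Theorems namespace of a single-conjunct summit repeats the summit name by design (D-0017)
set_option linter.dupNamespace false

noncomputable section

open scoped Classical NumberField ContRepresentation
open Field NumberField IsDedekindDomain WeierstrassCurve Literature.NumberTheory.EllipticCurves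
  Literature.NumberTheory.GaloisRepresentations Literature.NumberTheory.GaloisRepresentations.DiscreteGaloisModule
  Literature.NumberTheory.GaloisCohomology Literature.NumberTheory.GaloisCohomology.KolyvaginDatum
  Summit.BirchSwinnertonDyer.Rank1Residual.GaloisImage

namespace Summit.BirchSwinnertonDyer.BirchSwinnertonDyer.Theorems.KimAtThreeStubOfLiftable

/-- **The stub at `∅` (item 19561's conclusion) from (L-a) rigidity at `d₀`, (L-c) proportionality at `d₀`,
(iii) three counts, (iv) the order of `g_∅`** — module docstring. For `W/ℚ` with `ρ̄_{E,3}` onto, levels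
`k ≤ k̃`, the reduction `red : E[3^{k̃}·3] → E[3^k·3]` (`x ↦ 3^{k̃−k}x`), data `D_k` (level `k`) and `D̃`
(level `k̃`, primes `𝒫̃ ⊆ 𝒫(D_k)` inside the class of `τ` at level `3^{k̃+1}`, outside `S`), cyclotomic
transverse conditions, canonical comparison maps for one `η`, Kolyvagin systems `g` (level `k`) and `g̃`
(level `k̃`) for `𝓕_can`: THEN `g(∅) = 3^{n₀}•e + m'` with `e ∈ H¹_{𝓕_can}(ℚ, E[3^{k+1}])`,
`m' ∈ H¹_𝓚(ℚ, E[3^{k+1}])` (here `m' = 0`). [cite: MazurRubin2004, Thm. 4.4.3 (pp. 46–47) and Thm. 4.4.1 (p. 45)]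
[cite: Sakamoto2024, Thm. 4.4 (p. 926)] -/
theorem stubShape_of_coreVertex_inputs (W : WeierstrassCurve ℚ) [W.IsElliptic]
    (hsurj : W.HasSurjectiveModNGaloisRep ((3 : ℕ) : ℤ)) {k kt : ℕ} (hkk : k ≤ kt) {n₀ : ℕ}
    (red : (W.torsionGaloisModule (((3 : ℕ) : ℤ) ^ kt * ((3 : ℕ) : ℤ))).toContRepresentation →ⁱL
      (W.torsionGaloisModule (((3 : ℕ) : ℤ) ^ k * ((3 : ℕ) : ℤ))).toContRepresentation)
    (hred : ∀ x : geomTorsion W (((3 : ℕ) : ℤ) ^ kt * ((3 : ℕ) : ℤ)),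
      ((red x : geomTorsion W (((3 : ℕ) : ℤ) ^ k * ((3 : ℕ) : ℤ))) : geomPoints W) =
        (((3 : ℕ) : ℤ) ^ (kt - k)) • (x : geomPoints W))
    -- the bad set and the class
    {S : Finset (Place ℚ)} (hS : ∀ w : InfinitePlace ℚ, (Sum.inl w : Place ℚ) ∈ S)
    (h3S : ∀ v : HeightOneSpectrum (𝓞 ℚ), ((3 : ℕ) : 𝓞 ℚ) ∈ v.asIdeal → (Sum.inr v : Place ℚ) ∈ S)
    (hbadS : ∀ v : HeightOneSpectrum (𝓞 ℚ), ¬ W.HasGoodReductionAt v → (Sum.inr v : Place ℚ) ∈ S)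
    {Sset : Set (HeightOneSpectrum (𝓞 ℚ))} {τ : absoluteGaloisGroup ℚ}
    -- the data at the two levels
    {Dk : KolyvaginDatum (W.torsionGaloisModule (((3 : ℕ) : ℤ) ^ k * ((3 : ℕ) : ℤ)))}
    {Dt : KolyvaginDatum (W.torsionGaloisModule (((3 : ℕ) : ℤ) ^ kt * ((3 : ℕ) : ℤ)))}
    (hPP : Dt.primes ⊆ Dk.primes)
    (hPc : Dt.primes ⊆ frobeniusClassPrimes
      (W.torsionGaloisModule (((3 : ℕ) : ℤ) ^ kt * ((3 : ℕ) : ℤ))) Sset τ (3 ^ (kt + 1)))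
    (hPS : ∀ q ∈ Dt.primes, (Sum.inr q : Place ℚ) ∉ S)
    (hTk : Dk.transverse = cyclotomicTransverse _) (hTt : Dt.transverse = cyclotomicTransverse _)
    {η : (q : HeightOneSpectrum (𝓞 ℚ)) → (ZMod (Ideal.absNorm q.asIdeal))ˣ}
    (hDk : Dk.HasCanonicalComparison (3 ^ (k + 1)) η) (hDt : Dt.HasCanonicalComparison (3 ^ (kt + 1)) η)
    -- the Kolyvagin systems at the two levels
    {g : Finset (HeightOneSpectrum (𝓞 ℚ)) →
      galoisCohomology (W.torsionGaloisModule (((3 : ℕ) : ℤ) ^ k * ((3 : ℕ) : ℤ))) 1}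
    (hg : Dk.IsKolyvaginSystem (propagatedSelmerStructure W 3 k) g)
    {gt : Finset (HeightOneSpectrum (𝓞 ℚ)) →
      galoisCohomology (W.torsionGaloisModule (((3 : ℕ) : ℤ) ^ kt * ((3 : ℕ) : ℤ))) 1}
    (hgt : Dt.IsKolyvaginSystem (propagatedSelmerStructure W 3 kt) gt)
    -- (L-a) rigidity at `d₀` on the Kolyvagin systems of the restricted datum
    {d₀ : Finset (HeightOneSpectrum (𝓞 ℚ))}
    (hinj : ∀ s : Finset (HeightOneSpectrum (𝓞 ℚ)) →
        galoisCohomology (W.torsionGaloisModule (((3 : ℕ) : ℤ) ^ k * ((3 : ℕ) : ℤ))) 1,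
      ({ Dk with primes := Dt.primes } : KolyvaginDatum _).IsKolyvaginSystem
          (propagatedSelmerStructure W 3 k) s → s d₀ = 0 → s ∅ = 0)
    -- (L-c) proportionality at `d₀`
    (hd₀ : Dt.IsLevel d₀) {w : ℤ} (hw : IsCoprime w 3)
    (hcmp : galoisCohomology.map red 1 (gt d₀) = w • g d₀)
    -- (iii) the three counts on `S̃ = H¹_{𝓕_can}(ℚ, E[3^{k̃+1}])`
    [Finite (propagatedSelmerStructure W 3 kt).selmerGroup]
    (hcard : Nat.card (propagatedSelmerStructure W 3 kt).selmerGroup = 3 ^ (kt + 1 + n₀))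
    (hcardj : Nat.card {y : (propagatedSelmerStructure W 3 kt).selmerGroup // 3 ^ (kt - k) • y = 0} =
      3 ^ (kt - k + n₀))
    (hcardtop : Nat.card {y : (propagatedSelmerStructure W 3 kt).selmerGroup // 3 ^ kt • y = 0} =
      3 ^ (kt + n₀))
    -- (iv) the order of the bottom class
    (hord : addOrderOf (g ∅) * 3 ^ n₀ = 3 ^ (k + 1)) :
    ∃ e ∈ (propagatedSelmerStructure W 3 k).selmerGroup,
      ∃ m' ∈ (W.kummerSelmerStructure (((3 : ℕ) : ℤ) ^ k * ((3 : ℕ) : ℤ))).selmerGroup,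
        g ∅ = 3 ^ n₀ • e + m' := by
  haveI : Fact (Nat.Prime 3) := ⟨Nat.prime_three⟩
  haveI : Fact (1 < 3 ^ (k + 1)) := ⟨Nat.one_lt_pow (Nat.succ_ne_zero _) (by norm_num)⟩
  haveI : NeZero (3 ^ (k + 1)) := ⟨pow_ne_zero _ (by norm_num)⟩
  haveI : Finite (geomTorsion W (((3 : ℕ) : ℤ) ^ k * ((3 : ℕ) : ℤ))) := finite_geomTorsion_pow_mul W 3 k
  -- (L-b): the push-forward of `g̃` is a Kolyvagin system for the restricted datum (landed)
  have hDk' : ({ Dk with primes := Dt.primes } : KolyvaginDatum _).HasCanonicalComparison (3 ^ (k + 1)) η :=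
    KSRestrict.hasCanonicalComparison_restrictPrimes hDk hPP
  have hmap : ({ Dk with primes := Dt.primes } : KolyvaginDatum _).IsKolyvaginSystem
      (propagatedSelmerStructure W 3 k) fun d => galoisCohomology.map red 1 (gt d) :=
    isKolyvaginSystem_map_red_of_le W hkk red hred hS h3S hbadS (D := { Dk with primes := Dt.primes })
      rfl hPc hPS hTt hTk hDt hDk' hgt
  -- (ii): liftability of `g ∅` through `d₀` (landed)
  have hx := exists_lift_apply_empty_of_coreVertex W k kt red hPP hg hgt hmap hinj hd₀ hw hcmp
  -- the stub algebra with (i) discharged (landed)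
  exact stubShape_of_liftable_three_of_surj W hsurj k kt hkk red hred hcard hcardj hcardtop hx hord

end Summit.BirchSwinnertonDyer.BirchSwinnertonDyer.Theorems.KimAtThreeStubOfLiftable

end
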